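import Summits.CriticalPhenomena.SAWScalingLimit.Theses.SAWLoopFugacityFlow
import Summits.CriticalPhenomena.SAWScalingLimit.Theorems.AvoidanceLimit.Negative.AvoidanceLimitExponentRigidity
import Literature.Probability.RandomPlanarGeometry.RestrictionMeasuresInteriorHolds
import Literature.Probability.RandomPlanarGeometry.OneSidedRestrictionHolds
import Literature.Probability.RandomPlanarGeometry.RestrictionMeasuresProofs
import Literature.Probability.RandomPlanarGeometry.RestrictionMeasuresFiveEighths

/-!
# Skeleton line `thin-fill-pins-exponent` for the crux `AvoidanceLimit` (stmt-CriticalPhenomena-10649)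

Crux (route SAWLoopFugacityFlow, rank 2):
`Summit.CriticalPhenomena.SAWScalingLimit.Theses.SAWLoopFugacityFlow.AvoidanceLimit` — for every
Dobrushin domain `(D; a, b)`, hull subdomain `D'`, endpoint approximation, chordal uniformizer `φ`,
pulled-back hull `A = closure (ℍ ∖ φ⁻¹ D')` and restriction data `(Φ, d = Φ'_A(0))`, the critical
`δℤ²`-SAW probability `P_δ(range γ_δ ⊆ closure D')` tends to `d ^ (5/8)` as `δ → 0+`.

## The line (idea card `Ideas/thin-fill-pins-exponent.md`, triage r1-1/2/3: pass)

The VALUE `5/8` is pinned topologically and is never computed: a two-sided chordal restriction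
measure `P_α` ([LSW] Def. 3.4) almost every sample of which has EMPTY INTERIOR has `α = 5/8`
(`thin_pins_five_eighths`, PROVED below from the tree's discharges of [LSW] Cor. 8.6, Thm. 7.3,
uniqueness of `P_α` and positivity of restriction exponents). So the crux factors as

* `stub_restrictionForm` — the value-free restriction FORM `∃ α, AvoidanceLimitExp α` (the crux
  with `5/8 ↦ α`; `AvoidanceLimitExp` is the landed Negative-lemma family of
  `Theorems/AvoidanceLimit/Negative/AvoidanceLimitExponentRigidity.lean`, imported, and
  `AvoidanceLimitExp (5/8) ↔ AvoidanceLimit` by `Iff.rfl`): the generic output of any symmetry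
  transport — in this route, of
  the `n`-continuation WITHOUT exponent bookkeeping (cards `continue-the-defect`, IsingWindow /
  FugacityAnalyticity weakened to covariance + uniform bound); the HARDEST stub;
* three lattice thinness events at `x = x_c`, needed in ONE reference domain only (the square
  `bigSq = (-2,2)²` marked at `±2` of the Negative lemmas; triage r1-1 sharpening), for every
  endpoint approximation: `stub_nullArea` (one-point decay), `stub_noLakes` (no `ε`-return after an
  `r`-excursion — the no-self-approach half of the route's crux (S) `SimpleSubseqLimits`, not new
  debt), `stub_noBoundaryTouch` (no boundary crawling away from `a, b`);
* `stub_rangeLimitLaw` — the hyperspace PACKAGING (the card's Transfer): under the FORM with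
  exponent `α`, `NoLakes` and `NoBoundaryTouch`, the Hausdorff scaling limit (along a subsequence) of
  the critical SAW range in `bigSq`, pulled to `ℍ` by the chordal chart `φ`, is a law `P` on [LSW]'s
  configuration space `Ω` with `IsRestrictionMeasure α P`, linked to the lattice by the portmanteau
  inequality for open-ball hitting events (`BallLink`). By uniqueness of `P_α` the link is then a
  property of THE restriction measure of exponent `α`.

Proved here (no `sorry`): `thin_of_ballLink` (BallLink + NullArea ⇒ `P`-a.e. configuration has
empty interior: a configuration with an interior point contains a point of a countable dense set,
and each point of `ℍ` is hit with probability `≤ limsup_δ` of a lattice one-point function that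
tends to `0`), the hinge `thin_pins_five_eighths`, and the glue `avoidanceLimitExp_five_eighths_of` (the five
stub STATEMENTS imply `AvoidanceLimitExp (5/8)`); the skeleton theorem `AvoidanceLimit_of`
concludes the route decl BY NAME by applying the glue to the five registered stubs
(`avoidanceLimitExp_iff`), so its only `sorry`s are the stubs'.

## Disproof.lean (cycles 1+2) honoured

* `avoidanceLimit_false_without_chordal`, `…_without_hullEq`: the chart of `stub_rangeLimitLaw` is
  a CHORDAL uniformizer of `bigSq` (so `a ↦ 0`, `b ↦ ∞`, `closure K ∩ ℝ = {0}` and the avoided sets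
  are the pulled-back `*`-hulls); `…_without_normalisation`, `…_without_deriv`: `IsRestrictionMeasure`
  evaluates `P[K ∩ A = ∅] = d^α` on honest restriction data only; `…_without_reachable`: every
  lattice statement is along an `IsEndpointApprox` (laws eventually probability measures).
* Exponent rigidity (cycle 2, `avoidanceLimit_not_exp`, `avoidanceLimitExp_unique`): "no
  exponent-blind argument can prove the crux without an input that singles out `5/8`" — here that
  input is THINNESS (`stub_nullArea ∧ stub_noLakes`) through [LSW] Cor. 8.6 / Thm. 7.3, not a
  closed-form exponent; `stub_restrictionForm` is deliberately exponent-blind and strictly weaker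
  than the crux (it is consistent with `α = 1/2`, the crux is not). `not_avoidanceLimitExp_of_neg`
  and `IsRestrictionMeasure.exponent_pos` make a positivity hypothesis unnecessary (triage r1-2 (1)).
* No stub is an instance of a landed Negative lemma: none drops the chordal / reachability /
  normalisation / derivative / hull-identification clauses (they sit inside `AvoidanceLimitExp`).

[LSW] = Lawler–Schramm–Werner, Conformal restriction: the chordal case, JAMS 16 (2003),
arXiv:math/0209343; LSW04 = On the scaling limit of planar self-avoiding walk, arXiv:math/0204277,
§4.1 Prediction 1 (restriction exponent 5/8), p. 21 (the limit set should have `d_H = 4/3 < 2`).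
-/

noncomputable section

open Set Filter Topology MeasureTheory Metric
open UpperHalfPlane (upperHalfPlaneSet isOpen_upperHalfPlaneSet)
open Literature.Probability.RandomPlanarGeometry Literature.Probability.LatticeModels
open Summit.CriticalPhenomena.SAWScalingLimit.Theses.SAWLoopFugacityFlow (AvoidanceLimit)
open Summit.CriticalPhenomena.SAWScalingLimit.Theorems.AvoidanceLimit.Negative
  (AvoidanceLimitExp avoidanceLimitExp_iff bigSq)
open scoped ENNReal NNReal

namespace Summit.CriticalPhenomena.SAWScalingLimit.Cruxes.AvoidanceLimit.ThinFillPinsExponent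

/-! ### The three lattice thinness events (critical SAW law in a Dobrushin domain) -/

/-- **One-point decay** (`NullArea`) of the critical SAW chord of `(D; a, b)` along the endpoint
approximation `(a_δ, b_δ)`: the chord comes `ε`-close to a fixed point `z ∈ D` with probability
`→ 0` as `ε → 0+`, uniformly in the mesh (`limsup` over `δ → 0+` first). Predicted order
`ε^(2 - 4/3) = ε^(2/3)` (bulk one-arm exponent of the SAW); a first-moment statement. It makes every
Hausdorff subsequential limit of the ranges Lebesgue-null, hence with empty interior. -/
def NullAreaAt (D : DobrushinDomain) (a b : ℝ → Site 2) : Prop :=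
  ∀ z ∈ D.carrier, Tendsto (fun ε : ℝ => limsup
      (fun δ => ((SAW.law D.carrier δ (a δ) (b δ)).map (fun γ => γ.curve))
        {c : CurveClass ℂ | (c.range ∩ ball z ε).Nonempty}) (𝓝[>] (0 : ℝ)))
    (𝓝[>] 0) (𝓝 0)

/-- **No lakes** (`NoLakes`, the no-macroscopic-self-approach half of the route's crux (S)
`SimpleSubseqLimits`): for every `r > 0`, the probability that the critical SAW chord returns
within `ε` of one of its points `γ_i` at a later point `γ_j` after an excursion `γ_k`,
`i ≤ k ≤ j`, of size `≥ r` from `γ_i` tends to `0` as `ε → 0+`, uniformly in the mesh. It makes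
the complement of every Hausdorff subsequential limit of the ranges connected (no enclosed open
set, no pinching at `a`, `b`): the limit set is its own fill. -/
def NoLakesAt (D : DobrushinDomain) (a b : ℝ → Site 2) : Prop :=
  ∀ r : ℝ, 0 < r → Tendsto (fun ε : ℝ => limsup
      (fun δ => (SAW.law D.carrier δ (a δ) (b δ))
        {γ | ∃ i j : Fin (γ.walk.length + 1), i ≤ j ∧
          dist (meshPoint δ (γ.walk.getVert i)) (meshPoint δ (γ.walk.getVert j)) ≤ ε ∧
          ∃ k : Fin (γ.walk.length + 1), i ≤ k ∧ k ≤ j ∧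
            r ≤ dist (meshPoint δ (γ.walk.getVert i)) (meshPoint δ (γ.walk.getVert k))})
        (𝓝[>] (0 : ℝ)))
    (𝓝[>] 0) (𝓝 0)

/-- **No boundary touching** (`NoBoundaryTouch`) away from the marked points: for every `r > 0`,
the probability that the critical SAW chord comes `ε`-close to `∂D` outside `B(a, r) ∪ B(b, r)`
tends to `0` as `ε → 0+`, uniformly in the mesh. It gives `closure K ∩ ℝ = {0}` for the limit set
pulled back to `ℍ` by a chordal chart. -/
def NoBoundaryTouchAt (D : DobrushinDomain) (a b : ℝ → Site 2) : Prop :=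
  ∀ r : ℝ, 0 < r → Tendsto (fun ε : ℝ => limsup
      (fun δ => ((SAW.law D.carrier δ (a δ) (b δ)).map (fun γ => γ.curve))
        {c : CurveClass ℂ | ∃ z ∈ c.range, infDist z (frontier D.carrier) ≤ ε ∧
          r ≤ dist z (D.pt 0) ∧ r ≤ dist z (D.pt 1)}) (𝓝[>] (0 : ℝ)))
    (𝓝[>] 0) (𝓝 0)

/-- **Lattice link of a law on [LSW]'s configuration space** to the critical SAW in the reference
square `bigSq` along `(a_δ, b_δ)` through the chart `φ : ℍ → bigSq`: for every open ball `B ⊆ ℍ`,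
`P[K ∩ B ≠ ∅] ≤ limsup_{δ → 0+} P_δ[range γ_δ ∋ φ(w) for some w ∈ B]` — the portmanteau
inequality for the OPEN hitting event of `φ(B)` along a Hausdorff-convergent subsequence (whose
`limsup` is dominated by the full one). This is everything the thinness transfer uses of "`P` is
the scaling limit of the SAW range". -/
def BallLink (P : Measure RestrictionConfig) (a b : ℝ → Site 2)
    (φ : ConformalEquiv upperHalfPlaneSet bigSq.carrier) : Prop :=
  ∀ z ∈ upperHalfPlaneSet, ∀ ε : ℝ, 0 < ε → ball z ε ⊆ upperHalfPlaneSet →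
    P {K : RestrictionConfig | ((K : Set ℂ) ∩ ball z ε).Nonempty} ≤
      limsup (fun δ => ((SAW.law bigSq.carrier δ (a δ) (b δ)).map (fun γ => γ.curve))
        {c : CurveClass ℂ | ∃ w ∈ ball z ε, φ w ∈ c.range}) (𝓝[>] (0 : ℝ))

/-! ### The registered stubs -/

/-- **Stub 1 (hardest) — value-free restriction FORM of the SAW avoidance law.** There is ONE real
exponent `α` such that, for every Dobrushin domain, hull subdomain, endpoint approximation and
restriction data `(φ, A, Φ, d)`, `P_δ(range γ_δ ⊆ closure D') → d ^ α` (`AvoidanceLimitExp α`: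
the crux with `5/8 ↦ α`). Conformal covariance + restriction form, NO value: strictly weaker than
the crux (consistent with `α = 1/2`, which the crux excludes, `avoidanceLimit_not_exp_half`). In
the route it is what the `n`-continuation from the `ℤ²`-Ising free fermion honestly transports
(covariance defect `Δ_δ(n) → 0` continued from the Ising window to `n = 0` by Vitali, card
`continue-the-defect`; then hull-multiplicativity + dilation invariance + [LSW] Prop. 3.3 give
`Φ'_A(0)^α`); sibling engines (SAWRestrictionRigidity's value-free `AvoidanceCocycleLimit` +
existence) output the same statement. -/
theorem stub_restrictionForm : ∃ α : ℝ, AvoidanceLimitExp α := by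
  sorry

/-- **Stub 2 — one-point decay of the critical SAW in the reference square** (`NullAreaAt bigSq`),
for every endpoint approximation of `(bigSq; 2, -2)`. Bulk one-arm estimate at `x_c`
(predicted `P_δ(γ_δ ∩ B(z, ε) ≠ ∅) ≲ ε^(2/3)`); must use criticality (for `x > x_c` the range is
space-filling, barrier `SupercriticalSAWSpaceFilling`). -/
theorem stub_nullArea :
    ∀ a b : ℝ → Site 2, SAW.IsEndpointApprox bigSq a b → NullAreaAt bigSq a b := by
  sorry

/-- **Stub 3 — no lakes for the critical SAW in the reference square** (`NoLakesAt bigSq`), for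
every endpoint approximation: no `ε`-near return after an `r`-excursion, `ε → 0` after `δ → 0`.
The no-macroscopic-self-approach estimate at `x_c` (half of the route's crux (S); only
sub-ballisticity and Kesten-pattern/Hammersley–Welsh bounds are in print). -/
theorem stub_noLakes :
    ∀ a b : ℝ → Site 2, SAW.IsEndpointApprox bigSq a b → NoLakesAt bigSq a b := by
  sorry

/-- **Stub 4 — no boundary crawling for the critical SAW in the reference square**
(`NoBoundaryTouchAt bigSq`), for every endpoint approximation: away from `B(±2, r)` the chord stays
at positive distance from the four (lattice-flat) sides, `ε → 0` after `δ → 0` (bridge /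
irreducible-bridge decay against a flat wall at `x_c`). -/
theorem stub_noBoundaryTouch :
    ∀ a b : ℝ → Site 2, SAW.IsEndpointApprox bigSq a b → NoBoundaryTouchAt bigSq a b := by
  sorry

/-- **Stub 5 (the Transfer) — the scaling limit of the critical SAW range is [LSW]'s `P_α`.**
Under the FORM with exponent `α`, no lakes and no boundary touching in `bigSq` along `(a_δ, b_δ)`,
and for a chordal chart `φ : (ℍ; 0, ∞) → (bigSq; 2, -2)`: there is a law `P` on the configuration
space `Ω` ([LSW] Def. 3.1) with `IsRestrictionMeasure α P` and the lattice link `BallLink P a b φ`.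
Intended proof (hyperspace packaging): ranges `⊆ closure bigSq` live in a compact Hausdorff
hyperspace, so a subsequence `δ_n → 0+` of the laws converges weakly; the limit compactum `C` is
a.s. connected, contains `±2`, meets `∂ bigSq` only there (NoBoundaryTouch, open events +
portmanteau), and has connected complement with no pinching at `±2` (NoLakes: a simple polyline
Hausdorff-close to a separating continuum has an `ε`-pinch after an `r`-excursion — Janiszewski);
`K := φ⁻¹(C ∖ {±2})` is then a.s. in `Ω`; `P[K ∩ A = ∅] = Φ'_A(0)^α` for `*`-hulls `A` with Jordan
complement from `AvoidanceLimitExp α` on the hull subdomains `φ(ℍ ∖ A_s)` of a strictly monotone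
smooth outer/inner approximation `A_s` (closed event `{range ⊆ closure D'}` vs open event, kernel
continuity of `s ↦ Φ'_{A_s}(0)`, equality off countably many `s`, squeeze — the residual packaging
debt named by triage r1-3, cf. the route's `AvoidancePassage` and `HullRestrictionNull`), and for
all `*`-hulls by `HullApproximation`; `BallLink` is portmanteau for the open event
`{C ∩ φ(B) ≠ ∅}`. Size M–L; planar topology + weak convergence, no SAW estimate. -/
theorem stub_rangeLimitLaw :
    ∀ (α : ℝ) (a b : ℝ → Site 2) (φ : ConformalEquiv upperHalfPlaneSet bigSq.carrier),
      AvoidanceLimitExp α → SAW.IsEndpointApprox bigSq a b → bigSq.IsChordalUniformizing φ →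
      NoLakesAt bigSq a b → NoBoundaryTouchAt bigSq a b →
      ∃ P : Measure RestrictionConfig, IsRestrictionMeasure α P ∧ BallLink P a b φ := by
  sorry

/-! ### Proved glue -/

/-- **Thinness transfer (PROVED): a linked law is carried by configurations with empty interior.**
If `P` satisfies the lattice link through `φ` and the one-point function of the critical SAW in
`bigSq` decays (`NullAreaAt bigSq a b`), then `P`-almost every configuration has empty interior:
each `z ∈ ℍ` is hit with probability `≤ limsup_δ P_δ(γ_δ ∩ B(φ z, ε') ≠ ∅) → 0` (continuity of `φ`
at `z`), and a configuration with an interior point contains a point of a countable dense set. -/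
theorem thin_of_ballLink {P : Measure RestrictionConfig} {a b : ℝ → Site 2}
    {φ : ConformalEquiv upperHalfPlaneSet bigSq.carrier}
    (hlink : BallLink P a b φ) (hnull : NullAreaAt bigSq a b) :
    ∀ᵐ K : RestrictionConfig ∂P, interior (K : Set ℂ) = ∅ := by
  -- Step 1: every point of `ℍ` is almost surely missed.
  have hpt : ∀ z ∈ upperHalfPlaneSet, P {K : RestrictionConfig | z ∈ (K : Set ℂ)} = 0 := by
    intro z hz
    set g : ℝ → ℝ≥0∞ := fun ε' => limsup
      (fun δ => ((SAW.law bigSq.carrier δ (a δ) (b δ)).map (fun γ => γ.curve))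
        {c : CurveClass ℂ | (c.range ∩ ball (φ z) ε').Nonempty}) (𝓝[>] (0 : ℝ)) with hg
    have hg0 : Tendsto g (𝓝[>] 0) (𝓝 0) := hnull (φ z) (φ.mapsTo hz)
    have hle : ∀ ε' : ℝ, 0 < ε' → P {K : RestrictionConfig | z ∈ (K : Set ℂ)} ≤ g ε' := by
      intro ε' hε'
      have hcont : ContinuousAt φ z :=
        φ.continuousOn.continuousAt (isOpen_upperHalfPlaneSet.mem_nhds hz)
      obtain ⟨ε₁, hε₁, hball₁⟩ := Metric.isOpen_iff.1 isOpen_upperHalfPlaneSet z hz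
      obtain ⟨ε₂, hε₂, hball₂⟩ :=
        Metric.mem_nhds_iff.1 (hcont.preimage_mem_nhds (ball_mem_nhds (φ z) hε'))
      have hε : 0 < min ε₁ ε₂ := lt_min hε₁ hε₂
      have hsub₁ : ball z (min ε₁ ε₂) ⊆ upperHalfPlaneSet :=
        (ball_subset_ball (min_le_left _ _)).trans hball₁
      have hsub₂ : ∀ w ∈ ball z (min ε₁ ε₂), φ w ∈ ball (φ z) ε' := fun w hw =>
        hball₂ (ball_subset_ball (min_le_right _ _) hw)
      calc P {K : RestrictionConfig | z ∈ (K : Set ℂ)}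
          ≤ P {K : RestrictionConfig | ((K : Set ℂ) ∩ ball z (min ε₁ ε₂)).Nonempty} :=
            measure_mono fun K hK => ⟨z, hK, mem_ball_self hε⟩
        _ ≤ limsup (fun δ => ((SAW.law bigSq.carrier δ (a δ) (b δ)).map (fun γ => γ.curve))
              {c : CurveClass ℂ | ∃ w ∈ ball z (min ε₁ ε₂), φ w ∈ c.range}) (𝓝[>] (0 : ℝ)) :=
            hlink z hz _ hε hsub₁
        _ ≤ g ε' := by
            refine limsup_le_limsup (Eventually.of_forall fun δ => ?_)
            exact measure_mono fun c ⟨w, hw, hwc⟩ => ⟨φ w, hwc, hsub₂ w hw⟩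
    exact nonpos_iff_eq_zero.1
      (ge_of_tendsto hg0 (eventually_nhdsWithin_of_forall fun ε' hε' => hle ε' hε'))
  -- Step 2: a configuration with an interior point contains a point of a countable dense set.
  obtain ⟨S, hSc, hSd⟩ := TopologicalSpace.exists_countable_dense ℂ
  have hsub : {K : RestrictionConfig | ¬ interior (K : Set ℂ) = ∅} ⊆
      ⋃ z ∈ {z ∈ S | z ∈ upperHalfPlaneSet}, {K : RestrictionConfig | z ∈ (K : Set ℂ)} := by
    intro K hK
    have hne : (interior (K : Set ℂ)).Nonempty := nonempty_iff_ne_empty.2 hK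
    obtain ⟨z, hzS, hzint⟩ := hSd.exists_mem_open isOpen_interior hne
    have hzK : z ∈ (K : Set ℂ) := interior_subset hzint
    exact mem_biUnion (show z ∈ {z ∈ S | z ∈ upperHalfPlaneSet} from
      ⟨hzS, K.subset_upperHalfPlaneSet hzK⟩) hzK
  rw [ae_iff]
  refine measure_mono_null hsub ((measure_biUnion_null_iff (hSc.mono fun z hz => hz.1)).2 ?_)
  rintro z ⟨-, hz⟩
  exact hpt z hz

/-- **The hinge (PROVED): thin restriction laws have exponent `5/8`.** A two-sided chordal
restriction measure `P_α` almost every sample of which has empty interior has `α = 5/8`: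
`α > 0` by `IsRestrictionMeasure.exponent_pos`, `α < 5/8` is excluded by [LSW] Cor. 8.6
(`not_exists_isRestrictionMeasure_of_lt_five_eighths_holds`), `α > 5/8` by Thm. 7.3 (SLE_κ plus
Brownian bubbles: a.e. sample has an interior point,
`exists_isRestrictionMeasure_ae_interior_nonempty_holds`) and uniqueness of `P_α`
(`IsRestrictionMeasure.ae_of_exists`). -/
theorem thin_pins_five_eighths {α : ℝ} {P : Measure RestrictionConfig}
    (hP : IsRestrictionMeasure α P)
    (hthin : ∀ᵐ K : RestrictionConfig ∂P, interior (K : Set ℂ) = ∅) : α = 5 / 8 := by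
  have hα : 0 < α := hP.exponent_pos
  by_contra hne
  rcases lt_or_gt_of_ne hne with hlt | hgt
  · exact not_exists_isRestrictionMeasure_of_lt_five_eighths_holds hα hlt ⟨P, hP⟩
  · have hne' : ∀ᵐ K : RestrictionConfig ∂P, (interior (K : Set ℂ)).Nonempty :=
      hP.ae_of_exists (exists_isRestrictionMeasure_ae_interior_nonempty_holds α hgt)
    have hfalse : ∀ᵐ K ∂P, False := by
      filter_upwards [hthin, hne'] with K h1 h2
      rw [h1] at h2
      exact Set.not_nonempty_empty h2
    haveI := hP.isProbabilityMeasure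
    exact IsProbabilityMeasure.ne_zero P (ae_eq_bot.1 (eventually_false_iff_eq_bot.1 hfalse))

/-! ### The composition: the five stubs imply the crux, by name -/

/-- **Glue (PROVED, no `sorry`): the five stub STATEMENTS imply `AvoidanceLimitExp (5/8)`**
(hypotheses verbatim the statements of `stub_restrictionForm`, `stub_nullArea`, `stub_noLakes`,
`stub_noBoundaryTouch`, `stub_rangeLimitLaw`, in this order): fix the reference square with an
endpoint approximation (`SAW.exists_isEndpointApprox`) and a chordal chart
(`MarkedDomain.exists_isChordalUniformizing_holds`); the packaging gives `P_α` with the lattice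
link, `thin_of_ballLink` makes it thin, the hinge gives `α = 5/8`. -/
theorem avoidanceLimitExp_five_eighths_of
    (hform : ∃ α : ℝ, AvoidanceLimitExp α)
    (hnull : ∀ a b : ℝ → Site 2, SAW.IsEndpointApprox bigSq a b → NullAreaAt bigSq a b)
    (hlakes : ∀ a b : ℝ → Site 2, SAW.IsEndpointApprox bigSq a b → NoLakesAt bigSq a b)
    (hbdry : ∀ a b : ℝ → Site 2, SAW.IsEndpointApprox bigSq a b → NoBoundaryTouchAt bigSq a b)
    (hpack : ∀ (α : ℝ) (a b : ℝ → Site 2) (φ : ConformalEquiv upperHalfPlaneSet bigSq.carrier),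
      AvoidanceLimitExp α → SAW.IsEndpointApprox bigSq a b → bigSq.IsChordalUniformizing φ →
      NoLakesAt bigSq a b → NoBoundaryTouchAt bigSq a b →
      ∃ P : Measure RestrictionConfig, IsRestrictionMeasure α P ∧ BallLink P a b φ) :
    AvoidanceLimitExp ((5 : ℝ) / 8) := by
  obtain ⟨α, hα⟩ := hform
  obtain ⟨a, b, hab⟩ := SAW.exists_isEndpointApprox bigSq
  obtain ⟨φ, hφ⟩ := MarkedDomain.exists_isChordalUniformizing_holds bigSq
  obtain ⟨P, hP, hlink⟩ := hpack α a b φ hα hab hφ (hlakes a b hab) (hbdry a b hab)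
  have h58 : α = 5 / 8 := thin_pins_five_eighths hP (thin_of_ballLink hlink (hnull a b hab))
  subst h58
  exact hα

/-- **The skeleton theorem: the crux `AvoidanceLimit` BY NAME from the five registered stubs** —
the proved glue `avoidanceLimitExp_five_eighths_of` applied to `stub_restrictionForm`,
`stub_nullArea`, `stub_noLakes`, `stub_noBoundaryTouch`, `stub_rangeLimitLaw`, read through
`avoidanceLimitExp_iff` (`Iff.rfl`). Its only `sorry`s are the five stubs'. -/
theorem AvoidanceLimit_of :
    Summit.CriticalPhenomena.SAWScalingLimit.Theses.SAWLoopFugacityFlow.AvoidanceLimit :=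
  avoidanceLimitExp_iff.1 (avoidanceLimitExp_five_eighths_of stub_restrictionForm stub_nullArea
    stub_noLakes stub_noBoundaryTouch stub_rangeLimitLaw)

end Summit.CriticalPhenomena.SAWScalingLimit.Cruxes.AvoidanceLimit.ThinFillPinsExponent

end
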